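import Literature.MathematicalPhysics.QuantumLattice.VariationalPrincipleLocalKMSRows
import Literature.MathematicalPhysics.QuantumLattice.BogoliubovInequalityGeneral
import HarnessLib

/-!
# Bogoliubov's inequality for every translation-invariant solution of the variational principle (infinite volume)

Topic `Literature/MathematicalPhysics/QuantumLattice` (family `hubbard`; companion of `VariationalPrincipleLocalKMSRows`, which proves
Araki–Moriya's Theorem 12.11 «variational principle ⇒ local KMS / energy–entropy-balance rows» by the PERTURBATION PRINCIPLE
`InfVolFermionState.IsTranslationInvariant.re_expect_nonneg_of_gibbs_perturbation_const`).

**Bogoliubov's inequality** ([DLS1978] (28), Bogoliubov 1962; for equilibrium (KMS) states of the infinite quantum lattice system it is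
the input of the Klein–Landau–Shucker proof of the Mermin–Wagner theorem [KleinLandauShucker1981]): for the Gibbs state `⟨·⟩` of a
Hermitian `H` at inverse temperature `β ≥ 0` and arbitrary `A, C`,
`|⟨[C, A]⟩|² ≤ ½β ⟨AAᴴ + AᴴA⟩ ⟨[Cᴴ,[H,C]]⟩` (tree: `bogoliubov_inequality_general'`, and its LINEAR row form `bogoliubov_row_nonneg`:
`0 ≤ Re⟨AAᴴ + AᴴA⟩ + 2Re⟨CA − AC⟩ + ½β Re⟨[Cᴴ,[H,C]]⟩`).

This file PROVES the inequality for EVERY translation-invariant state `ω` of the infinite lattice-fermion system on `ℤ^d` (`d ≥ 1`)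
solving the variational principle of a Hermitian, even, translation-covariant finite-range interaction `Ψ` at `β ≥ 0` — in
particular for every `IsVarEquilibrium β Ψ R` state — with `H` replaced by any local Hamiltonian `H_{Λ'}`, `Λ' ⊇ thicken Λ R`, and
`A, C ∈ 𝔄_Λ` local (charged or not), `Ã = Γ_{Λ⊆Λ'}A`, `C̃ = Γ_{Λ⊆Λ'}C` (by finite range `[H_{Λ'}, C̃] = δ_Ψ(C)` does not depend on `Λ'`):

* `InfVolFermionState.IsTranslationInvariant.bogoliubovRow_nonneg_of_variationalPrinciple` — the row form
  `0 ≤ Re ω(ÃÃᴴ + ÃᴴÃ) + 2 Re ω(C̃Ã − ÃC̃) + ½β Re ω(C̃ᴴ[H_{Λ'},C̃] − [H_{Λ'},C̃]C̃ᴴ)`;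
* `InfVolFermionState.IsTranslationInvariant.bogoliubov_inequality_of_variationalPrinciple` — the printed form
  `‖ω(C̃Ã − ÃC̃)‖² ≤ ½β · Re ω(ÃÃᴴ + ÃᴴÃ) · Re ω(C̃ᴴ[H_{Λ'},C̃] − [H_{Λ'},C̃]C̃ᴴ)` (optimise the row over `A ↦ λe^{iθ}A`);
* `InfVolFermionState.IsVarEquilibrium.bogoliubovRow_nonneg`, `InfVolFermionState.IsVarEquilibrium.bogoliubov_inequality` — the same for
  every translation-invariant equilibrium state (`TIVariationalPressure.IsVarEquilibrium`).

These are the `bog` rows of the thermal moment relaxations (hubbard-thermal THERMAL-SOURCES §2g), now valid constraints on ALL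
translation-invariant equilibrium states of the infinite system, not only on limits of finite-volume Gibbs states.

## Proof

The row is LINEAR in the state, so the perturbation principle applies: with `M` the row operator and `X` its even Hermitian part,
perturb the box Hamiltonian `βH_{[0,m+w)^d}` by `tY`, `Y = Σ_y Γ(τ_{y+v})X`; for the perturbed Gibbs state `ρ_t` the
finite-volume row for ITS Hamiltonian `βH_box + tY` (`bogoliubov_row_nonneg` at inverse temperature `1`) differs from the row
against `βH_box` by `½t Re ρ_t(c̃ᴴ[Y,c̃] − [Y,c̃]c̃ᴴ)`, `c̃ = Γ(τ_{y+v})C̃`, which graded locality bounds by `t·|Λ||Λ'|·2‖X‖‖C‖²`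
uniformly in the volume (`norm_conjTranspose_mul_commutator_sum_translates_le`), while `[H_box, c̃] = Γ(τ_{y+v})[H_{Λ'}, C̃]`
(`FermionInteraction.localHamiltonian_halfOpenBox_commutator_translate`). §1 is the matrix-level perturbation lemma
(`Matrix.IsHermitian.re_gibbsState_bogoliubovRow_perturb_ge`, root namespace `Matrix`), §2 the rows, §3 the quadratic form and the
equilibrium-state forms. Everything is PROVED (standard axioms); no definition, no named fact.

## Mathlib / tree search

REUSED: `bogoliubov_row_nonneg` (`BogoliubovInequalityGeneral`, [DLS1978] (28) in row form), `abs_re_gibbsState_le`,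
`IsTranslationInvariant.re_expect_nonneg_of_gibbs_perturbation_const`, `apply_evenHermPart_eq`, `isHermitian_evenHermPart`,
`parityAut_evenHermPart`, `fermionEmbed_evenHermPart`, `gibbsState_parityAut_of_parityAut_eq`, `norm_conjTranspose_mul_commutator_sum_translates_le`,
`FermionInteraction.localHamiltonian_halfOpenBox_commutator_translate`, `IsVarEquilibrium.tendsto_boxEntropy_div`
(`VariationalPrincipleLocalKMSRows`); Mathlib `Matrix.l2_opNorm_conjTranspose`.
`lean search 'bogoliubov'` (2026-08-28): finite-volume Gibbs states only (`BogoliubovInequality*`, `DuhamelLogMeanBound`).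

## References

* [DLS1978] F. J. Dyson, E. H. Lieb, B. Simon, J. Stat. Phys. 18 (1978) 335–383, §2 eq. (28) (Bogoliubov's inequality for arbitrary
  operators). [cite: DLS1978, §2 eq. (28)]
* A. Klein, L. J. Landau, D. S. Shucker, *On the absence of spontaneous breakdown of continuous symmetry for equilibrium states in two
  dimensions*, J. Stat. Phys. 26 (1981) 505–512 (Bogoliubov's inequality for KMS states ⇒ Mermin–Wagner for all equilibrium states).
  [cite: KleinLandauShucker1981]
* H. Araki, H. Moriya, Rev. Math. Phys. 15 (2003) 93, Thm. 12.11 (variational principle ⇒ dKMS). [cite: ArakiMoriya2003, Theorem 12.11]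
* R. B. Israel, *Convexity in the Theory of Lattice Gases* (1979), §I.2 (tangent functionals). [cite: Israel1979, Thm. I.2.4]
-/

noncomputable section

open scoped ComplexOrder BigOperators Matrix.Norms.L2Operator
open Finset Literature.InformationTheory.Entropy

namespace Matrix

open Literature.MathematicalPhysics.QuantumLattice

variable {n : Type*} [Fintype n] [DecidableEq n]

/-! ### §1 The finite-volume Bogoliubov row of a linearly perturbed Gibbs state, against the unperturbed Hamiltonian -/

omit [Fintype n] [DecidableEq n] in
/-- Real multiples of Hermitian matrices are Hermitian. [folklore] -/
private theorem isHermitian_ofReal_smul_bog {A : Matrix n n ℂ} (r : ℝ) (hA : A.IsHermitian) : ((r : ℂ) • A).IsHermitian := by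
  rw [IsHermitian, conjTranspose_smul, hA.eq]
  simp only [Complex.star_def, Complex.conj_ofReal]

omit [DecidableEq n] in
/-- The double-commutator row operator against `H₀ + tY` splits. [folklore] -/
private theorem doubleCommRow_add_smul (H₀ Y c : Matrix n n ℂ) (t : ℂ) :
    cᴴ * ((H₀ + t • Y) * c - c * (H₀ + t • Y)) - ((H₀ + t • Y) * c - c * (H₀ + t • Y)) * cᴴ =
      (cᴴ * (H₀ * c - c * H₀) - (H₀ * c - c * H₀) * cᴴ) + t • (cᴴ * (Y * c - c * Y) - (Y * c - c * Y) * cᴴ) := by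
  have h : (H₀ + t • Y) * c - c * (H₀ + t • Y) = (H₀ * c - c * H₀) + t • (Y * c - c * Y) := by
    rw [Matrix.add_mul, Matrix.mul_add, Matrix.smul_mul, Matrix.mul_smul, smul_sub]
    abel
  rw [h, Matrix.mul_add, Matrix.add_mul, Matrix.mul_smul, Matrix.smul_mul, smul_sub]
  abel

/-- **The Bogoliubov row of a linearly perturbed Gibbs state, measured against the UNPERTURBED Hamiltonian.** For Hermitian `H₀, Y`,
real `t` and all matrices `a, c`, the Gibbs state `ρ_t` of `H₀ + tY` (at inverse temperature `1`) satisfies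
`Re ρ_t(aaᴴ + aᴴa) + 2Re ρ_t(ca − ac) + ½Re ρ_t(cᴴ[H₀,c] − [H₀,c]cᴴ) ≥ −½|t|(‖cᴴ[Y,c]‖ + ‖c[Y,cᴴ]‖)`: the exact Bogoliubov row of
`ρ_t` for ITS Hamiltonian (`bogoliubov_row_nonneg`) minus the perturbation of the double commutator. [cite: DLS1978, §2 eq. (28)] -/
theorem IsHermitian.re_gibbsState_bogoliubovRow_perturb_ge {H₀ Y : Matrix n n ℂ} (hH₀ : H₀.IsHermitian) (hY : Y.IsHermitian)
    [Nonempty n] (t : ℝ) (a c : Matrix n n ℂ) :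
    -(|t| / 2 * (‖cᴴ * (Y * c - c * Y)‖ + ‖c * (Y * cᴴ - cᴴ * Y)‖)) ≤
      (gibbsState 1 (H₀ + (t : ℂ) • Y) (a * aᴴ + aᴴ * a)).re + 2 * (gibbsState 1 (H₀ + (t : ℂ) • Y) (c * a - a * c)).re +
        1 / 2 * (gibbsState 1 (H₀ + (t : ℂ) • Y) (cᴴ * (H₀ * c - c * H₀) - (H₀ * c - c * H₀) * cᴴ)).re := by
  have hH : (H₀ + (t : ℂ) • Y).IsHermitian := hH₀.add (isHermitian_ofReal_smul_bog t hY)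
  have hrow := bogoliubov_row_nonneg hH a c zero_le_one
  have hsplit : (gibbsState 1 (H₀ + (t : ℂ) • Y) (cᴴ * ((H₀ + (t : ℂ) • Y) * c - c * (H₀ + (t : ℂ) • Y)) -
      ((H₀ + (t : ℂ) • Y) * c - c * (H₀ + (t : ℂ) • Y)) * cᴴ)).re =
        (gibbsState 1 (H₀ + (t : ℂ) • Y) (cᴴ * (H₀ * c - c * H₀) - (H₀ * c - c * H₀) * cᴴ)).re +
          t * ((gibbsState 1 (H₀ + (t : ℂ) • Y) (cᴴ * (Y * c - c * Y))).re -
            (gibbsState 1 (H₀ + (t : ℂ) • Y) ((Y * c - c * Y) * cᴴ)).re) := by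
    rw [doubleCommRow_add_smul, map_add, map_smul, Complex.add_re, smul_eq_mul, Complex.re_ofReal_mul, map_sub, Complex.sub_re,
      map_sub, Complex.sub_re]
  rw [hsplit] at hrow
  have hbd1 : |(gibbsState 1 (H₀ + (t : ℂ) • Y) (cᴴ * (Y * c - c * Y))).re| ≤ ‖cᴴ * (Y * c - c * Y)‖ :=
    abs_re_gibbsState_le hH 1 _
  have e2 : ‖(Y * c - c * Y) * cᴴ‖ = ‖c * (Y * cᴴ - cᴴ * Y)‖ := by
    rw [← Matrix.l2_opNorm_conjTranspose ((Y * c - c * Y) * cᴴ), Matrix.conjTranspose_mul, conjTranspose_conjTranspose,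
      Matrix.conjTranspose_sub, Matrix.conjTranspose_mul, Matrix.conjTranspose_mul, hY.eq, ← norm_neg, ← Matrix.mul_neg, neg_sub]
  have hbd2 : |(gibbsState 1 (H₀ + (t : ℂ) • Y) ((Y * c - c * Y) * cᴴ)).re| ≤ ‖c * (Y * cᴴ - cᴴ * Y)‖ :=
    (abs_re_gibbsState_le hH 1 _).trans e2.le
  have ht : t * ((gibbsState 1 (H₀ + (t : ℂ) • Y) (cᴴ * (Y * c - c * Y))).re -
      (gibbsState 1 (H₀ + (t : ℂ) • Y) ((Y * c - c * Y) * cᴴ)).re) ≤ |t| * (‖cᴴ * (Y * c - c * Y)‖ + ‖c * (Y * cᴴ - cᴴ * Y)‖) := by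
    calc t * ((gibbsState 1 (H₀ + (t : ℂ) • Y) (cᴴ * (Y * c - c * Y))).re -
          (gibbsState 1 (H₀ + (t : ℂ) • Y) ((Y * c - c * Y) * cᴴ)).re)
        ≤ |t * ((gibbsState 1 (H₀ + (t : ℂ) • Y) (cᴴ * (Y * c - c * Y))).re -
          (gibbsState 1 (H₀ + (t : ℂ) • Y) ((Y * c - c * Y) * cᴴ)).re)| := le_abs_self _
      _ = |t| * |(gibbsState 1 (H₀ + (t : ℂ) • Y) (cᴴ * (Y * c - c * Y))).re -
          (gibbsState 1 (H₀ + (t : ℂ) • Y) ((Y * c - c * Y) * cᴴ)).re| := abs_mul _ _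
      _ ≤ |t| * (‖cᴴ * (Y * c - c * Y)‖ + ‖c * (Y * cᴴ - cᴴ * Y)‖) := by
          refine mul_le_mul_of_nonneg_left ((abs_sub _ _).trans ?_) (abs_nonneg t)
          linarith
  linarith

end Matrix

namespace Literature.MathematicalPhysics.QuantumLattice

open Matrix Literature.Probability.LatticeModels ThermodynamicLimit
open _root_.Filter
open scoped _root_.Topology

variable {d : ℕ}

/-! ### §2 The Bogoliubov rows of a solution of the variational principle -/

/-- The row operator read through a linear functional. [folklore] -/
private theorem re_apply_bogRow {m : Type*} [Fintype m] (φ : Matrix m m ℂ →ₗ[ℂ] ℂ) (a c Z : Matrix m m ℂ) (β : ℝ) :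
    (φ (a * aᴴ + aᴴ * a + ((2 : ℝ) : ℂ) • (c * a - a * c) + ((β / 2 : ℝ) : ℂ) • (cᴴ * Z - Z * cᴴ))).re =
      (φ (a * aᴴ + aᴴ * a)).re + 2 * (φ (c * a - a * c)).re + β / 2 * (φ (cᴴ * Z - Z * cᴴ)).re := by
  rw [map_add, map_add, map_smul, map_smul, Complex.add_re, Complex.add_re, smul_eq_mul, smul_eq_mul, Complex.re_ofReal_mul,
    Complex.re_ofReal_mul]

section Rows

variable (hd : 0 < d) {Ψ : FermionInteraction d} {R : ℝ} (hH : Ψ.IsHermitian) (hE : Ψ.IsEven)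
  (hT : Ψ.IsTranslationInvariant) (hR : Ψ.HasFiniteRange R) {β : ℝ} (hβ : 0 ≤ β) {ω : InfVolFermionState d}
  (hω : ω.IsTranslationInvariant)
  (hS : Tendsto (fun n : ℕ => vonNeumannEntropy (ω.rdm (halfOpenBox d n)) / ((n : ℝ) ^ d)) atTop
    (𝓝 (Ψ.freePressure β + β * ω.meanEnergy Ψ R)))
include hd hH hE hT hR hβ hω hS

/-- **BOGOLIUBOV'S INEQUALITY FOR A SOLUTION OF THE VARIATIONAL PRINCIPLE, row form.** Let `Ψ` be Hermitian, even, translation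
covariant, of finite range `R` on `ℤ^d` (`d ≥ 1`), `β ≥ 0`, and `ω` translation invariant with
`S(ω_{[0,n)^d})/n^d → P_free(β,Ψ) + β e_Ψ(ω)`. Then for all finite `Λ`, `Λ' ⊇ thicken Λ R` and all `A, C ∈ 𝔄_Λ`:
`0 ≤ Re ω(ÃÃᴴ + ÃᴴÃ) + 2 Re ω(C̃Ã − ÃC̃) + ½β Re ω(C̃ᴴ(H_{Λ'}C̃ − C̃H_{Λ'}) − (H_{Λ'}C̃ − C̃H_{Λ'})C̃ᴴ)`.
[cite: DLS1978, §2 eq. (28)] [cite: KleinLandauShucker1981] [cite: ArakiMoriya2003, Theorem 12.11] -/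
theorem InfVolFermionState.IsTranslationInvariant.bogoliubovRow_nonneg_of_variationalPrinciple
    {Λ Λ' : Finset (Site d)} (hΛR : thicken Λ R ⊆ Λ') (A C : FermionOp Λ) :
    0 ≤ (ω.expect Λ' (fermionEmbed (PolySite.incl ((subset_thicken Λ R).trans hΛR)) A *
            (fermionEmbed (PolySite.incl ((subset_thicken Λ R).trans hΛR)) A)ᴴ +
          (fermionEmbed (PolySite.incl ((subset_thicken Λ R).trans hΛR)) A)ᴴ *
            fermionEmbed (PolySite.incl ((subset_thicken Λ R).trans hΛR)) A)).re +
      2 * (ω.expect Λ' (fermionEmbed (PolySite.incl ((subset_thicken Λ R).trans hΛR)) C *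
            fermionEmbed (PolySite.incl ((subset_thicken Λ R).trans hΛR)) A -
          fermionEmbed (PolySite.incl ((subset_thicken Λ R).trans hΛR)) A *
            fermionEmbed (PolySite.incl ((subset_thicken Λ R).trans hΛR)) C)).re +
      β / 2 * (ω.expect Λ' ((fermionEmbed (PolySite.incl ((subset_thicken Λ R).trans hΛR)) C)ᴴ *
            (Ψ.localHamiltonian Λ' * fermionEmbed (PolySite.incl ((subset_thicken Λ R).trans hΛR)) C -
              fermionEmbed (PolySite.incl ((subset_thicken Λ R).trans hΛR)) C * Ψ.localHamiltonian Λ') -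
          (Ψ.localHamiltonian Λ' * fermionEmbed (PolySite.incl ((subset_thicken Λ R).trans hΛR)) C -
              fermionEmbed (PolySite.incl ((subset_thicken Λ R).trans hΛR)) C * Ψ.localHamiltonian Λ') *
            (fermionEmbed (PolySite.incl ((subset_thicken Λ R).trans hΛR)) C)ᴴ)).re := by
  classical
  set Γ := fermionEmbed (PolySite.incl ((subset_thicken Λ R).trans hΛR)) with hΓ
  set a := Γ A with ha
  set c := Γ C with hc
  set Z : FermionOp Λ' := Ψ.localHamiltonian Λ' * c - c * Ψ.localHamiltonian Λ' with hZ
  set M : FermionOp Λ' := a * aᴴ + aᴴ * a + ((2 : ℝ) : ℂ) • (c * a - a * c) + ((β / 2 : ℝ) : ℂ) • (cᴴ * Z - Z * cᴴ) with hM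
  set X : FermionOp Λ' := (2 : ℂ)⁻¹ • ((2 : ℂ)⁻¹ • (M + Mᴴ) + parityAut ((2 : ℂ)⁻¹ • (M + Mᴴ))) with hXdef
  have hωX : ω.expect Λ' X = ((ω.expect Λ' M).re : ℂ) :=
    apply_evenHermPart_eq (ω.expect_conjTranspose Λ') ((hω.isEven hd) Λ') M
  have hre : (ω.expect Λ' M).re = (ω.expect Λ' X).re := by rw [hωX, Complex.ofReal_re]
  rw [← re_apply_bogRow (ω.expect Λ') a c Z β, ← hM, hre]
  -- the volume-independent first-order constant `½(K_C + K_{Cᴴ})`, `K_B = ‖B‖·|Λ||Λ'|·2‖X‖‖B‖`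
  refine hω.re_expect_nonneg_of_gibbs_perturbation_const hd hH hE hT hR hβ hS (isHermitian_evenHermPart M)
    (parityAut_evenHermPart M)
    (C := (‖C‖ * ((Λ.card * Λ'.card : ℕ) * (2 * ‖X‖ * ‖C‖)) + ‖Cᴴ‖ * ((Λ.card * Λ'.card : ℕ) * (2 * ‖X‖ * ‖Cᴴ‖))) / 2)
    (div_nonneg (add_nonneg
      (mul_nonneg (norm_nonneg _) (mul_nonneg (Nat.cast_nonneg _) (mul_nonneg (mul_nonneg zero_le_two (norm_nonneg _)) (norm_nonneg _))))
      (mul_nonneg (norm_nonneg _) (mul_nonneg (Nat.cast_nonneg _) (mul_nonneg (mul_nonneg zero_le_two (norm_nonneg _)) (norm_nonneg _)))))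
      zero_le_two) fun m w v hv y hy t ht => ?_
  -- the finite-volume row in the box `[0, m+w)^d`
  set Kn := Ψ.localHamiltonian (halfOpenBox d (m + w)) with hKn
  set Y := ∑ y' ∈ (halfOpenBox d m).attach,
    fermionEmbed ((PolySite.shiftEmb (y'.1 + v) Λ').trans (PolySite.incl (shiftSet_add_subset_halfOpenBox hv y'.2))) X with hYdef
  have hYh : Y.IsHermitian := by
    rw [hYdef, Matrix.IsHermitian, Matrix.conjTranspose_sum]
    refine Finset.sum_congr rfl fun y' _ => ?_
    rw [← fermionEmbed_conjTranspose, (isHermitian_evenHermPart M).eq]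
  have hYe : parityAut Y = Y := by
    rw [hYdef, map_sum]
    refine Finset.sum_congr rfl fun y' _ => ?_
    rw [← fermionEmbed_parityAut, parityAut_evenHermPart]
  have hKh : Kn.IsHermitian := FermionInteraction.localHamiltonian_isHermitian hH _
  have hKe : parityAut Kn = Kn := FermionInteraction.parityAut_localHamiltonian hE _
  have hH₀ : (((β : ℝ) : ℂ) • Kn).IsHermitian := by
    rw [Matrix.IsHermitian, conjTranspose_smul, hKh.eq]; simp only [Complex.star_def, Complex.conj_ofReal]
  have hHt : (((β : ℝ) : ℂ) • Kn + (t : ℂ) • Y).IsHermitian := by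
    refine hH₀.add ?_
    rw [Matrix.IsHermitian, conjTranspose_smul, hYh.eq]; simp only [Complex.star_def, Complex.conj_ofReal]
  have hHe : parityAut (((β : ℝ) : ℂ) • Kn + (t : ℂ) • Y) = ((β : ℝ) : ℂ) • Kn + (t : ℂ) • Y := by
    rw [map_add, map_smul, map_smul, hKe, hYe]
  set Tu := fermionEmbed ((PolySite.shiftEmb (y + v) Λ').trans (PolySite.incl (shiftSet_add_subset_halfOpenBox hv hy))) with hTu
  -- the translate of the row operator is the row operator of the translates, against `βK_n`
  have hloc := Ψ.localHamiltonian_halfOpenBox_commutator_translate hE hT hR hΛR (shiftSet_add_subset_halfOpenBox hv hy) C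
  have hTZ : Tu Z = Kn * Tu c - Tu c * Kn := by rw [hZ, hc, hΓ, ← hloc]
  have hTM : Tu M = Tu a * (Tu a)ᴴ + (Tu a)ᴴ * Tu a + ((2 : ℝ) : ℂ) • (Tu c * Tu a - Tu a * Tu c) +
      ((β / 2 : ℝ) : ℂ) • ((Tu c)ᴴ * (Kn * Tu c - Tu c * Kn) - (Kn * Tu c - Tu c * Kn) * (Tu c)ᴴ) := by
    rw [hM, map_add, map_add, map_smul, map_smul, map_add, map_sub, map_sub, map_mul, map_mul, map_mul, map_mul, map_mul, map_mul,
      hTZ, fermionEmbed_conjTranspose, fermionEmbed_conjTranspose]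
  have hgX : gibbsState 1 (((β : ℝ) : ℂ) • Kn + (t : ℂ) • Y) (Tu X) =
      (((gibbsState 1 (((β : ℝ) : ℂ) • Kn + (t : ℂ) • Y) (Tu M)).re : ℂ)) := by
    rw [hXdef, fermionEmbed_evenHermPart]
    exact apply_evenHermPart_eq (fun B => gibbsState_conjTranspose 1 hHt B)
      (fun B => gibbsState_parityAut_of_parityAut_eq hHe 1 B) (Tu M)
  rw [hgX, Complex.ofReal_re, hTM, re_apply_bogRow]
  -- the matrix row against `βK_n`, with `½β Re ρ(c̃ᴴ[K_n,c̃] − …) = ½ Re ρ(c̃ᴴ[βK_n,c̃] − …)`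
  have h := hH₀.re_gibbsState_bogoliubovRow_perturb_ge hYh t (Tu a) (Tu c)
  have hsc : (Tu c)ᴴ * ((((β : ℝ) : ℂ) • Kn) * Tu c - Tu c * (((β : ℝ) : ℂ) • Kn)) -
      ((((β : ℝ) : ℂ) • Kn) * Tu c - Tu c * (((β : ℝ) : ℂ) • Kn)) * (Tu c)ᴴ =
        ((β : ℝ) : ℂ) • ((Tu c)ᴴ * (Kn * Tu c - Tu c * Kn) - (Kn * Tu c - Tu c * Kn) * (Tu c)ᴴ) := by
    rw [Matrix.smul_mul, Matrix.mul_smul, ← smul_sub, Matrix.mul_smul, Matrix.smul_mul, ← smul_sub]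
  rw [hsc, map_smul, smul_eq_mul, Complex.re_ofReal_mul, abs_of_nonneg ht] at h
  -- the first-order constants
  have h1 := norm_conjTranspose_mul_commutator_sum_translates_le ((subset_thicken Λ R).trans hΛR) C (parityAut_evenHermPart M) hv
    (shiftSet_add_subset_halfOpenBox hv hy) (m := m) (x := y)
  have h2 := norm_conjTranspose_mul_commutator_sum_translates_le ((subset_thicken Λ R).trans hΛR) Cᴴ (parityAut_evenHermPart M) hv
    (shiftSet_add_subset_halfOpenBox hv hy) (m := m) (x := y)
  rw [fermionEmbed_conjTranspose, fermionEmbed_conjTranspose, conjTranspose_conjTranspose] at h2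
  rw [← hXdef, ← hYdef, ← hΓ, ← hc, ← hTu] at h1 h2
  have h12 : t / 2 * (‖(Tu c)ᴴ * (Y * Tu c - Tu c * Y)‖ + ‖Tu c * (Y * (Tu c)ᴴ - (Tu c)ᴴ * Y)‖) ≤
      t * ((‖C‖ * ((Λ.card * Λ'.card : ℕ) * (2 * ‖X‖ * ‖C‖)) + ‖Cᴴ‖ * ((Λ.card * Λ'.card : ℕ) * (2 * ‖X‖ * ‖Cᴴ‖))) / 2) := by
    nlinarith [h1, h2, ht]
  have e : 1 / 2 * (β * (gibbsState 1 (((β : ℝ) : ℂ) • Kn + (t : ℂ) • Y)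
      ((Tu c)ᴴ * (Kn * Tu c - Tu c * Kn) - (Kn * Tu c - Tu c * Kn) * (Tu c)ᴴ)).re) =
      β / 2 * (gibbsState 1 (((β : ℝ) : ℂ) • Kn + (t : ℂ) • Y)
        ((Tu c)ᴴ * (Kn * Tu c - Tu c * Kn) - (Kn * Tu c - Tu c * Kn) * (Tu c)ᴴ)).re := by ring
  linarith

/-- **BOGOLIUBOV'S INEQUALITY FOR A SOLUTION OF THE VARIATIONAL PRINCIPLE** (Dyson–Lieb–Simon (28) in infinite volume):
`‖ω(C̃Ã − ÃC̃)‖² ≤ ½β · Re ω(ÃÃᴴ + ÃᴴÃ) · Re ω(C̃ᴴ[H_{Λ'},C̃] − [H_{Λ'},C̃]C̃ᴴ)` for all local `A, C ∈ 𝔄_Λ`, `Λ' ⊇ thicken Λ R`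
(from the rows for `A ↦ λe^{iθ}A`, `λ > 0`). [cite: DLS1978, §2 eq. (28)] [cite: KleinLandauShucker1981] [cite: ArakiMoriya2003, Theorem 12.11] -/
theorem InfVolFermionState.IsTranslationInvariant.bogoliubov_inequality_of_variationalPrinciple
    {Λ Λ' : Finset (Site d)} (hΛR : thicken Λ R ⊆ Λ') (A C : FermionOp Λ) :
    ‖ω.expect Λ' (fermionEmbed (PolySite.incl ((subset_thicken Λ R).trans hΛR)) C *
          fermionEmbed (PolySite.incl ((subset_thicken Λ R).trans hΛR)) A -
        fermionEmbed (PolySite.incl ((subset_thicken Λ R).trans hΛR)) A *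
          fermionEmbed (PolySite.incl ((subset_thicken Λ R).trans hΛR)) C)‖ ^ 2 ≤
      β / 2 * (ω.expect Λ' (fermionEmbed (PolySite.incl ((subset_thicken Λ R).trans hΛR)) A *
            (fermionEmbed (PolySite.incl ((subset_thicken Λ R).trans hΛR)) A)ᴴ +
          (fermionEmbed (PolySite.incl ((subset_thicken Λ R).trans hΛR)) A)ᴴ *
            fermionEmbed (PolySite.incl ((subset_thicken Λ R).trans hΛR)) A)).re *
        (ω.expect Λ' ((fermionEmbed (PolySite.incl ((subset_thicken Λ R).trans hΛR)) C)ᴴ *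
            (Ψ.localHamiltonian Λ' * fermionEmbed (PolySite.incl ((subset_thicken Λ R).trans hΛR)) C -
              fermionEmbed (PolySite.incl ((subset_thicken Λ R).trans hΛR)) C * Ψ.localHamiltonian Λ') -
          (Ψ.localHamiltonian Λ' * fermionEmbed (PolySite.incl ((subset_thicken Λ R).trans hΛR)) C -
              fermionEmbed (PolySite.incl ((subset_thicken Λ R).trans hΛR)) C * Ψ.localHamiltonian Λ') *
            (fermionEmbed (PolySite.incl ((subset_thicken Λ R).trans hΛR)) C)ᴴ)).re := by
  classical
  set Γ := fermionEmbed (PolySite.incl ((subset_thicken Λ R).trans hΛR)) with hΓ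
  set H := Ψ.localHamiltonian Λ' with hHdef
  set z : ℂ := ω.expect Λ' (Γ C * Γ A - Γ A * Γ C) with hz
  set P : ℝ := (ω.expect Λ' (Γ A * (Γ A)ᴴ + (Γ A)ᴴ * Γ A)).re with hP
  set Q : ℝ := (ω.expect Λ' ((Γ C)ᴴ * (H * Γ C - Γ C * H) - (H * Γ C - Γ C * H) * (Γ C)ᴴ)).re with hQ
  -- the rows for `A ↦ μ • A`, `μ ∈ ℂ`: `0 ≤ |μ|² P + 2 Re(μ z) + ½β Q`
  have hrow : ∀ μ : ℂ, 0 ≤ ‖μ‖ ^ 2 * P + 2 * (μ * z).re + β / 2 * Q := by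
    intro μ
    have h := hω.bogoliubovRow_nonneg_of_variationalPrinciple hd hH hE hT hR hβ hS hΛR (μ • A) C
    have e1 : Γ (μ • A) * (Γ (μ • A))ᴴ + (Γ (μ • A))ᴴ * Γ (μ • A) = ((‖μ‖ ^ 2 : ℝ) : ℂ) • (Γ A * (Γ A)ᴴ + (Γ A)ᴴ * Γ A) := by
      simp only [map_smul, conjTranspose_smul, Complex.star_def, Matrix.smul_mul, Matrix.mul_smul, smul_smul]
      rw [Complex.mul_conj', Complex.conj_mul', ← smul_add, Complex.ofReal_pow]
    have e2 : Γ C * Γ (μ • A) - Γ (μ • A) * Γ C = μ • (Γ C * Γ A - Γ A * Γ C) := by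
      rw [map_smul, Matrix.mul_smul, Matrix.smul_mul, smul_sub]
    rw [← hΓ, ← hHdef, e1, e2, map_smul, map_smul, smul_eq_mul, smul_eq_mul, Complex.re_ofReal_mul, ← hz, ← hP, ← hQ] at h
    exact h
  have hP0 : 0 ≤ P := by
    have h1 : 0 ≤ (ω.expect Λ' (Γ A * (Γ A)ᴴ)).re := by
      have h := ω.expect_nonneg Λ' (Γ A)ᴴ
      rw [conjTranspose_conjTranspose] at h
      exact (Complex.nonneg_iff.1 h).1
    have h2 : 0 ≤ (ω.expect Λ' ((Γ A)ᴴ * Γ A)).re := (Complex.nonneg_iff.1 (ω.expect_nonneg Λ' (Γ A))).1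
    rw [hP, map_add, Complex.add_re]; exact add_nonneg h1 h2
  have hQ0 : 0 ≤ β / 2 * Q := by
    have h := hrow 0
    rwa [norm_zero, zero_pow two_ne_zero, zero_mul, zero_mul, Complex.zero_re, mul_zero, zero_add, zero_add] at h
  -- the real quadratic `s ↦ ‖z‖²P s² − 2‖z‖² s + ½βQ ≥ 0` (`μ = −s z̄`) has nonpositive discriminant
  have hquad : ∀ s : ℝ, 0 ≤ ‖z‖ ^ 2 * P * (s * s) + -(2 * ‖z‖ ^ 2) * s + β / 2 * Q := by
    intro s
    have h := hrow (-((s : ℂ) * (starRingEnd ℂ) z))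
    have hn : ‖-((s : ℂ) * (starRingEnd ℂ) z)‖ ^ 2 = s ^ 2 * ‖z‖ ^ 2 := by
      rw [norm_neg, norm_mul, Complex.norm_real, Complex.norm_conj, mul_pow, Real.norm_eq_abs, sq_abs]
    have hre : (-((s : ℂ) * (starRingEnd ℂ) z) * z).re = -(s * ‖z‖ ^ 2) := by
      rw [neg_mul, Complex.neg_re, mul_assoc, Complex.conj_mul', ← Complex.ofReal_pow, ← Complex.ofReal_mul, Complex.ofReal_re]
    rw [hn, hre] at h
    have e : ‖z‖ ^ 2 * P * (s * s) + -(2 * ‖z‖ ^ 2) * s + β / 2 * Q = s ^ 2 * ‖z‖ ^ 2 * P + 2 * -(s * ‖z‖ ^ 2) + β / 2 * Q := by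
      ring
    rw [e]; exact h
  have hdisc := discrim_le_zero hquad
  rw [discrim] at hdisc
  show ‖z‖ ^ 2 ≤ β / 2 * P * Q
  rcases (sq_nonneg ‖z‖).eq_or_lt with hz0 | hzpos
  · rw [← hz0]
    have e : β / 2 * P * Q = P * (β / 2 * Q) := by ring
    rw [e]; exact mul_nonneg hP0 hQ0
  · have hfin : ‖z‖ ^ 2 * ‖z‖ ^ 2 ≤ ‖z‖ ^ 2 * (β / 2 * P * Q) := by nlinarith [hdisc]
    exact le_of_mul_le_mul_left hfin hzpos

end Rows

/-! ### §3 The equilibrium-state forms -/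

section Equilibrium

variable (hd : 0 < d) {Ψ : FermionInteraction d} {R : ℝ} (hH : Ψ.IsHermitian) (hE : Ψ.IsEven)
  (hT : Ψ.IsTranslationInvariant) (hR : Ψ.HasFiniteRange R) {β : ℝ} (hβ : 0 ≤ β) {ω : InfVolFermionState d}
include hd hH hE hT hR hβ

/-- **Every translation-invariant equilibrium state satisfies the Bogoliubov rows.** [cite: DLS1978, §2 eq. (28)]
[cite: KleinLandauShucker1981] [cite: ArakiMoriya2003, Theorem 12.11] -/
theorem InfVolFermionState.IsVarEquilibrium.bogoliubovRow_nonneg (h : ω.IsVarEquilibrium β Ψ R)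
    {Λ Λ' : Finset (Site d)} (hΛR : thicken Λ R ⊆ Λ') (A C : FermionOp Λ) :
    0 ≤ (ω.expect Λ' (fermionEmbed (PolySite.incl ((subset_thicken Λ R).trans hΛR)) A *
            (fermionEmbed (PolySite.incl ((subset_thicken Λ R).trans hΛR)) A)ᴴ +
          (fermionEmbed (PolySite.incl ((subset_thicken Λ R).trans hΛR)) A)ᴴ *
            fermionEmbed (PolySite.incl ((subset_thicken Λ R).trans hΛR)) A)).re +
      2 * (ω.expect Λ' (fermionEmbed (PolySite.incl ((subset_thicken Λ R).trans hΛR)) C *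
            fermionEmbed (PolySite.incl ((subset_thicken Λ R).trans hΛR)) A -
          fermionEmbed (PolySite.incl ((subset_thicken Λ R).trans hΛR)) A *
            fermionEmbed (PolySite.incl ((subset_thicken Λ R).trans hΛR)) C)).re +
      β / 2 * (ω.expect Λ' ((fermionEmbed (PolySite.incl ((subset_thicken Λ R).trans hΛR)) C)ᴴ *
            (Ψ.localHamiltonian Λ' * fermionEmbed (PolySite.incl ((subset_thicken Λ R).trans hΛR)) C -
              fermionEmbed (PolySite.incl ((subset_thicken Λ R).trans hΛR)) C * Ψ.localHamiltonian Λ') -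
          (Ψ.localHamiltonian Λ' * fermionEmbed (PolySite.incl ((subset_thicken Λ R).trans hΛR)) C -
              fermionEmbed (PolySite.incl ((subset_thicken Λ R).trans hΛR)) C * Ψ.localHamiltonian Λ') *
            (fermionEmbed (PolySite.incl ((subset_thicken Λ R).trans hΛR)) C)ᴴ)).re :=
  h.1.bogoliubovRow_nonneg_of_variationalPrinciple hd hH hE hT hR hβ (h.tendsto_boxEntropy_div hd hH hE hT hR hβ) hΛR A C

/-- **BOGOLIUBOV'S INEQUALITY FOR EVERY TRANSLATION-INVARIANT EQUILIBRIUM STATE** of an even finite-range lattice-fermion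
interaction on `ℤ^d`: `‖ω([C̃, Ã])‖² ≤ ½β · Re ω(ÃÃᴴ + ÃᴴÃ) · Re ω([C̃ᴴ,[H_{Λ'},C̃]])` for all local `A, C`.
[cite: DLS1978, §2 eq. (28)] [cite: KleinLandauShucker1981] [cite: ArakiMoriya2003, Theorem 12.11] -/
theorem InfVolFermionState.IsVarEquilibrium.bogoliubov_inequality (h : ω.IsVarEquilibrium β Ψ R)
    {Λ Λ' : Finset (Site d)} (hΛR : thicken Λ R ⊆ Λ') (A C : FermionOp Λ) :
    ‖ω.expect Λ' (fermionEmbed (PolySite.incl ((subset_thicken Λ R).trans hΛR)) C *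
          fermionEmbed (PolySite.incl ((subset_thicken Λ R).trans hΛR)) A -
        fermionEmbed (PolySite.incl ((subset_thicken Λ R).trans hΛR)) A *
          fermionEmbed (PolySite.incl ((subset_thicken Λ R).trans hΛR)) C)‖ ^ 2 ≤
      β / 2 * (ω.expect Λ' (fermionEmbed (PolySite.incl ((subset_thicken Λ R).trans hΛR)) A *
            (fermionEmbed (PolySite.incl ((subset_thicken Λ R).trans hΛR)) A)ᴴ +
          (fermionEmbed (PolySite.incl ((subset_thicken Λ R).trans hΛR)) A)ᴴ *
            fermionEmbed (PolySite.incl ((subset_thicken Λ R).trans hΛR)) A)).re *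
        (ω.expect Λ' ((fermionEmbed (PolySite.incl ((subset_thicken Λ R).trans hΛR)) C)ᴴ *
            (Ψ.localHamiltonian Λ' * fermionEmbed (PolySite.incl ((subset_thicken Λ R).trans hΛR)) C -
              fermionEmbed (PolySite.incl ((subset_thicken Λ R).trans hΛR)) C * Ψ.localHamiltonian Λ') -
          (Ψ.localHamiltonian Λ' * fermionEmbed (PolySite.incl ((subset_thicken Λ R).trans hΛR)) C -
              fermionEmbed (PolySite.incl ((subset_thicken Λ R).trans hΛR)) C * Ψ.localHamiltonian Λ') *
            (fermionEmbed (PolySite.incl ((subset_thicken Λ R).trans hΛR)) C)ᴴ)).re :=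
  h.1.bogoliubov_inequality_of_variationalPrinciple hd hH hE hT hR hβ (h.tendsto_boxEntropy_div hd hH hE hT hR hβ) hΛR A C

end Equilibrium

end Literature.MathematicalPhysics.QuantumLattice

end
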